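import Literature.NumberTheory.GaloisRepresentations.FramedRepTensorKronecker
import HarnessLib

/-!
# The clause "`D_pst` and `WD ∘ D_pst` are compatible with tensor products" for `p`-adic Hodge data
# — candidate clause (F15) of `IsFontaineDatum`, and the Kronecker frame bookkeeping it needs

Topic `Literature/NumberTheory/GaloisRepresentations`; companion of the accepted predicates
`PstWeilDeligneData.CyclotomicWeightNegOne` ((F2)), `UnramifiedWeightsZero` ((F3)),
`IsCrystallineFramed` ((F4)), `CyclotomicPowersLabelledWeights` ((F11)), `CrystallineDetOnInertia`
((F12)), `FontaineLaffailleReductions` ((F13)) and of `Literature.NumberTheory.PAdicHodge.FontaineDpst`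
(the specification `IsFontaineDatum` of Fontaine's PINNED datum `(B_dR(F), WD ∘ D_pst)` of the summit
`Langlands`, and its "Upgrade path": literature seats may ADD clauses that are theorems for the genuine
datum).  This file does not import `FontaineDpst` (it is meant to be imported BY it).

## Mathematics

Let `F/ℚ_ℓ` be finite, `ρ : Γ_F → GL_m(ℚ̄_ℓ)`, `ρ' : Γ_F → GL_n(ℚ̄_ℓ)` continuous.  (a) If `ρ` and `ρ'`
are de Rham then so is `ρ ⊗ ρ'` — Fontaine, Astérisque 223, Exp. III, Prop. 1.5.2: for a regular
`(ℚ_ℓ, Γ_F)`-ring `B` (here `B_dR(F)`, Thm. 1.5.2 ibid.) the `B`-admissible representations form a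
sub-Tannakian category of `Rep_{ℚ_ℓ}(Γ_F)`, stable under `⊗` (the comparison isomorphisms
`α_V`, `α_{V'}` give `α_{V ⊗ V'}`).  (b) If moreover `r ≅ WD(D_pst ρ)`, `r' ≅ WD(D_pst ρ')` and
`t ≅ WD(D_pst(ρ ⊗ ρ'))` as Weil–Deligne representations of `W_F` over `ℚ̄_ℓ`, then
`t ≅ r ⊗ r' := (r ⊗ r', N_r ⊗ 1 + 1 ⊗ N_{r'})` (Deligne, Antwerp II §8; Tate, Corvallis (4.1.5); tree
`WeilDeligneRep.tprod`): `D_pst(V) = ⋃_{F'} (B_st ⊗_{ℚ_ℓ} V)^{Γ_{F'}}` is an exact, faithful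
`⊗`-functor from potentially semistable (= de Rham, Berger 2002 Thm. 0.7) representations to filtered
`(φ, N, Gal(F̄/F))`-modules over `F₀^{nr}` (Fontaine, Exp. VIII §2.2–§2.3 with Exp. III Prop. 1.5.2
and §5.6 for `B_st`; Brinon–Conrad §9.1 p. 133, Prop. 9.1.9, Prop. 9.1.11), and
Fontaine's recipe `D ↦ WD(D)` (Exp. VIII §2.3.7; Deligne 1973 §8; Buzzard–Gee 2014 §2.2: underlying
space `D ⊗_{F₀^{nr} ⊗ ℚ̄_ℓ, τ} ℚ̄_ℓ`, `r(w) = φ^{-f α(w)} ∘ w̄`, same `N`) is visibly a `⊗`-functor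
(`φ`, `w̄` act diagonally on `D ⊗ D'`, and `N_{D ⊗ D'} = N ⊗ 1 + 1 ⊗ N'` by definition of the tensor
product of `(φ, N)`-modules, Exp. III §4), so `WD(D_pst(V ⊗ V')) ≅
WD(D_pst V) ⊗ WD(D_pst V')`; isomorphism classes of Weil–Deligne representations are stable under
`⊗` (`WeilDeligneRep.Equiv.tprodCongr` below).  This is the interface lemma through which the
local–global compatibility clause of the summit at `v ∣ ℓ` (`LocalGlobalCompatibleAt`, third conjunct:
`(𝓡.pst ℓ v hv).IsWeilDeligneOf (ρ.toLocal v) r`) passes to tensor products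
`ρ = σ₁ ⊗ σ₂` of avatars (`FramedRep.tensor`), e.g. for the Rankin–Selberg / Kronecker transports
`GL₂ × GL₂ → GL₄`, `GL₂ × GL₃ → GL₆` (Ramakrishnan 2000; Kim–Shahidi 2002).

Degenerate checks: `m = n = 1`, `ρ = ρ' = 1` (both sides the trivial one-dimensional Weil–Deligne
representation: consistent with (F8), PROVED below in general for unramified `ρ`, `ρ'`); `n = 1`,
`ρ' = ε^k` (Tate twists: (a) is then the accepted `PstWeilDeligneData.IsDeRhamFramed.tateTwist` /
`twist_det`, (b) says `WD(ρ(k)) ≅ WD(ρ) ⊗ WD(ε^k)`); `m · n = 0` (all framed representations of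
rank `0` are equal; (b) holds trivially up to the unique isomorphism of zero spaces).

## Why a clause (and not a theorem about `fontainePst`)

The accepted clauses (F1)–(F14) of `IsFontaineDatum` constrain the Weil–Deligne half
`IsWeilDeligneOf` of the datum only on unramified representations ((F3), (F8), structure axioms), on
the cyclotomic character ((F4)) and on ordinary representations ((F14)); no clause relates the
Weil–Deligne representations attached to `ρ`, `ρ'` and `ρ ⊗ ρ'` for RAMIFIED de Rham `ρ`, `ρ'`
(docstring of `FontaineDpst`: "a statement about `fontainePst` is provable exactly when it holds for
EVERY datum satisfying the clauses" — and a datum whose relation is twisted on the ramified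
positive-weight representations by a fixed non-trivial unramified character of `W_F` meets (F1)–(F14)
whenever Fontaine's does, while violating (b)).  Yet every functorial-transport cell of the
decomposition cell `decomp-langlands` that moves avatars through a tensor product needs exactly (b) at
the places `v ∣ ℓ` (census instrument I-g16.1 of route `WallWindowSplit`, critic advisory w1, rows
218/221 of the cell's CRITIC-LEDGER: items `WallKroneckerWindowTransport` 26618,
`WallExteriorSquareWindowTransport` 26619, `SpinWindowTransport` 28329, `AccidentalWindowTransport`
28330, `LowRankKroneckerTransport` 27368).  As clause (F15) of `IsFontaineDatum` it would be
discharged from `FontaineDatumExists` in one line, like (F11)–(F14).  Part (a) is stated as a clause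
too, but is expected to be a THEOREM for every datum: the algebraic core (`⊗`-stability of
`B`-admissibility for a regular period ring, pairing form) is the accepted
`PeriodRingData.isAdmissible_of_pairing` / `isAdmissible_tmul` of `PstWeilDeligneTwistDeRham`, and what
remains is the finite-model bookkeeping of `FramedRep.IsDeRhamWith` for a Kronecker product of models
over a compositum (done there for `n = 1`, `IsDeRhamFramed.twist_det`).
-- TODO(general form): Schur functors (`∧^k`, `Sym^k`: direct summands of `ρ^{⊗k}` in characteristic
-- `0`) — `WD(D_pst(∧² ρ)) ≅ ∧² WD(D_pst ρ)` needs, besides (b), the exactness half of Prop. 1.5.2 on the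
-- Weil–Deligne side (sub-object compatibility of `IsWeilDeligneOf`), for which the tree has no framed
-- `∧²` yet; and the discharge of (a) for every datum.

## What this file provides (no `sorry`, no named fact, no instance)

* **the clause** `PstWeilDeligneData.TensorCompatible 𝔇` with fields `tensorDeRham : 𝔇.TensorDeRham`
  ((F15a)) and `tensorWeilDeligne : 𝔇.TensorWeilDeligne` ((F15b)), and its user-facing form
  `TensorCompatible.exists_isWeilDeligneOf_tensor`;
* checks: `PstWeilDeligneData.tensorWeilDeligne_of_isLocallyUnramified` — **for every datum satisfying
  (F8), clause (b) HOLDS on unramified `ρ`, `ρ'`** (all three Weil–Deligne representations are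
  `≅ (·|_{W_F}, 0)` and `((ρ ⊗ ρ')|_{W_F}, 0) ≅ (ρ|_{W_F}, 0) ⊗ (ρ'|_{W_F}, 0)` in the Kronecker frame,
  accepted-to-be `FramedRep.isEquivalent_ofRep_weilRestrict_tensor` of file `FramedRepTensorKronecker`),
  so (F15) extends (F8) consistently; `tensorCompatible_unramifiedPstWeilDeligneData` — the accepted
  truncated model `F̂_nr` (`unramifiedPstWeilDeligneData`) satisfies (F15), both parts PROVED, so the
  clause does not by itself exclude junk data: it is a COMPATIBILITY clause, used together with
  (F2)–(F14).

## References

* J.-M. Fontaine, *Représentations p-adiques semi-stables*, Astérisque 223 (1994), Exp. III,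
  Prop. 1.5.2, Thm. 1.5.2 (admissible representations: sub-Tannakian, comparison isomorphism), §4
  (filtered `(φ, N)`-modules and their tensor products), §5.6 (`D_st`). [FontaineAsterisque223III]
* J.-M. Fontaine, *Représentations ℓ-adiques potentiellement semi-stables*, ibid., Exp. VIII, §1.1,
  §1.3, §2.2–§2.3, §2.3.7 (`D_pst`, the Weil–Deligne representation of a pst representation).
  [FontaineAsterisque223VIII]
* O. Brinon, B. Conrad, *CMI Summer School notes on p-adic Hodge theory* (2009), §9.1 p. 133,
  Prop. 9.1.9, Prop. 9.1.11 (exact faithful `⊗`-functors `D_cris`, `D_st`). [BrinonConrad2009]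
* L. Berger, *Représentations p-adiques et équations différentielles*, Invent. Math. 148 (2002),
  Thm. 0.7. [BergerLaurent2002]
* P. Deligne, *Les constantes des équations fonctionnelles des fonctions L*, Antwerp II, LNM 349
  (1973), §8 (Weil–Deligne representations, tensor products). [DeligneAntwerpII1973]
* J. Tate, *Number theoretic background*, Corvallis 1979, (4.1.2)–(4.1.5). [TateCorvallis1979]
* K. Buzzard, T. Gee, *The conjectural connections …* (2014), §2.2. [BuzzardGeeLMS2014]
-/

noncomputable section

open scoped TensorProduct Kronecker MatrixGroups Matrix
open Field

namespace Literature.NumberTheory.GaloisRepresentations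

/-! ### §4 The clause -/

namespace PstWeilDeligneData

variable {F : Type} [Field F] [ValuativeRel F] [TopologicalSpace F] [IsNonarchimedeanLocalField F]
  {ℓ : ℕ} [Fact ℓ.Prime]

/-- **(F15a) de Rham representations are `⊗`-stable for `𝔇`**: if the framed `ρ : Γ_F →ₜ* GL_m(ℚ̄_ℓ)`
and `ρ' : Γ_F →ₜ* GL_n(ℚ̄_ℓ)` are de Rham for the datum (`IsDeRhamFramed`), so is their Kronecker
product `FramedRep.tensor ρ ρ' : Γ_F →ₜ* GL_{mn}(ℚ̄_ℓ)`.  For the genuine datum: Fontaine 1994,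
Exp. III Prop. 1.5.2 (`B_dR`-admissible representations are stable under `⊗`); expected to be a theorem
for EVERY datum (accepted `PeriodRingData.isAdmissible_of_pairing` plus finite-model bookkeeping).
[cite: FontaineAsterisque223III, Prop. 1.5.2] -/
def TensorDeRham (𝔇 : PstWeilDeligneData F ℓ) : Prop :=
  ∀ ⦃m n : ℕ⦄ (ρ : FramedRep (absoluteGaloisGroup F) (PadicAlgCl ℓ) m)
    (ρ' : FramedRep (absoluteGaloisGroup F) (PadicAlgCl ℓ) n),
    𝔇.IsDeRhamFramed ρ → 𝔇.IsDeRhamFramed ρ' → 𝔇.IsDeRhamFramed (ρ.tensor ρ')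

/-- **(F15b) `WD ∘ D_pst` is compatible with `⊗`**: if `r`, `r'`, `t` are Weil–Deligne representations
the datum attaches to `ρ`, `ρ'` and `FramedRep.tensor ρ ρ'` respectively (`IsWeilDeligneOf`: intended
`≅ WD(D_pst ·)`), then `t ≅ r ⊗ r'` (`WeilDeligneRep.tprod`: `(r ⊗ r', N ⊗ 1 + 1 ⊗ N')`).  For the
genuine datum: `D_pst` is an exact faithful `⊗`-functor (Fontaine 1994, Exp. VIII §2.2–§2.3 with
Exp. III Prop. 1.5.2 and §5.6; Brinon–Conrad §9.1, Prop. 9.1.9, Prop. 9.1.11) and Fontaine's recipe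
`D ↦ WD(D)` is a `⊗`-functor (Exp. VIII §2.3.7; Deligne 1973 §8).
[cite: FontaineAsterisque223VIII, §2.3.7] [cite: BrinonConrad2009, §9.1 and Prop. 9.1.11]
[cite: DeligneAntwerpII1973, §8.4] -/
def TensorWeilDeligne (𝔇 : PstWeilDeligneData F ℓ) : Prop :=
  ∀ ⦃m n : ℕ⦄ (ρ : FramedRep (absoluteGaloisGroup F) (PadicAlgCl ℓ) m)
    (ρ' : FramedRep (absoluteGaloisGroup F) (PadicAlgCl ℓ) n)
    (r : WeilDeligneRep F (PadicAlgCl ℓ) (Fin m → PadicAlgCl ℓ))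
    (r' : WeilDeligneRep F (PadicAlgCl ℓ) (Fin n → PadicAlgCl ℓ))
    (t : WeilDeligneRep F (PadicAlgCl ℓ) (Fin (m * n) → PadicAlgCl ℓ)),
    𝔇.IsWeilDeligneOf ρ r → 𝔇.IsWeilDeligneOf ρ' r' → 𝔇.IsWeilDeligneOf (ρ.tensor ρ') t →
      t.IsEquivalent (r.tprod r')

/-- **Candidate clause (F15) of `IsFontaineDatum`: the datum is compatible with tensor products** —
(a) `TensorDeRham` (de Rham `⊗` de Rham is de Rham) and (b) `TensorWeilDeligne`
(`WD(ρ ⊗ ρ') ≅ WD(ρ) ⊗ WD(ρ')`).  Every field is a theorem of the literature for Fontaine's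
`(B_dR(F), WD ∘ D_pst)`; see the module docstring for why (b) is not derivable from (F1)–(F14).
[cite: FontaineAsterisque223III, Prop. 1.5.2] [cite: FontaineAsterisque223VIII, §2.3.7] -/
structure TensorCompatible (𝔇 : PstWeilDeligneData F ℓ) : Prop where
  /-- (F15a) de Rham `⊗` de Rham is de Rham. -/
  tensorDeRham : 𝔇.TensorDeRham
  /-- (F15b) the Weil–Deligne representation of a tensor product is the tensor product. -/
  tensorWeilDeligne : 𝔇.TensorWeilDeligne

/-- **User-facing form of (F15)**: for de Rham `ρ`, `ρ'` with attached Weil–Deligne representations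
`r`, `r'`, the Kronecker product `ρ ⊗ ρ'` is de Rham and has an attached Weil–Deligne representation,
and EVERY such is isomorphic to `r ⊗ r'`. [cite: FontaineAsterisque223VIII, §2.3.7] -/
theorem TensorCompatible.exists_isWeilDeligneOf_tensor {𝔇 : PstWeilDeligneData F ℓ}
    (h𝔇 : 𝔇.TensorCompatible) {m n : ℕ} {ρ : FramedRep (absoluteGaloisGroup F) (PadicAlgCl ℓ) m}
    {ρ' : FramedRep (absoluteGaloisGroup F) (PadicAlgCl ℓ) n}
    {r : WeilDeligneRep F (PadicAlgCl ℓ) (Fin m → PadicAlgCl ℓ)}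
    {r' : WeilDeligneRep F (PadicAlgCl ℓ) (Fin n → PadicAlgCl ℓ)}
    (hρ : 𝔇.IsDeRhamFramed ρ) (hρ' : 𝔇.IsDeRhamFramed ρ') (hr : 𝔇.IsWeilDeligneOf ρ r)
    (hr' : 𝔇.IsWeilDeligneOf ρ' r') :
    𝔇.IsDeRhamFramed (ρ.tensor ρ') ∧ (∃ t, 𝔇.IsWeilDeligneOf (ρ.tensor ρ') t) ∧
      ∀ t, 𝔇.IsWeilDeligneOf (ρ.tensor ρ') t → t.IsEquivalent (r.tprod r') := by
  have hdR := h𝔇.tensorDeRham ρ ρ' hρ hρ'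
  exact ⟨hdR, hdR.exists_isWeilDeligneOf, fun t ht => h𝔇.tensorWeilDeligne ρ ρ' r r' t hr hr' ht⟩

/-- **(F8) already forces (F15b) on unramified representations.**  For ANY datum whose Weil–Deligne
relation has Fontaine's Frobenius normalisation on unramified representations (clause (F8) of
`IsFontaineDatum`, taken here as the hypothesis `h8` verbatim), and unramified `ρ`, `ρ'`:
every `t` attached to `ρ ⊗ ρ'` is `≅ r ⊗ r'` — all three are `≅ (·|_{W_F}, 0)`, and
`((ρ ⊗ ρ')|_{W_F}, 0) ≅ (ρ|_{W_F}, 0) ⊗ (ρ'|_{W_F}, 0)` in the Kronecker frame.  So (F15) is a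
consistent extension of (F8) off the unramified representations.
[cite: FontaineAsterisque223VIII, §1.3 and §2.3.7] -/
theorem tensorWeilDeligne_of_isLocallyUnramified (𝔇 : PstWeilDeligneData F ℓ)
    (h8 : ∀ {n : ℕ} (ρ : FramedRep (absoluteGaloisGroup F) (PadicAlgCl ℓ) n)
      (r : WeilDeligneRep F (PadicAlgCl ℓ) (Fin n → PadicAlgCl ℓ)) (hρ : ρ.IsLocallyUnramified),
      𝔇.IsWeilDeligneOf ρ r →
        r.IsEquivalent
          (WeilDeligneRep.ofRep (ρ.weilRestrict F) hρ.isUnramifiedRep_weilRestrict.isContinuousRep))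
    {m n : ℕ} {ρ : FramedRep (absoluteGaloisGroup F) (PadicAlgCl ℓ) m}
    {ρ' : FramedRep (absoluteGaloisGroup F) (PadicAlgCl ℓ) n} (hρ : ρ.IsLocallyUnramified)
    (hρ' : ρ'.IsLocallyUnramified) {r : WeilDeligneRep F (PadicAlgCl ℓ) (Fin m → PadicAlgCl ℓ)}
    {r' : WeilDeligneRep F (PadicAlgCl ℓ) (Fin n → PadicAlgCl ℓ)}
    {t : WeilDeligneRep F (PadicAlgCl ℓ) (Fin (m * n) → PadicAlgCl ℓ)}
    (hr : 𝔇.IsWeilDeligneOf ρ r) (hr' : 𝔇.IsWeilDeligneOf ρ' r') (ht : 𝔇.IsWeilDeligneOf (ρ.tensor ρ') t) :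
    t.IsEquivalent (r.tprod r') :=
  ((h8 _ t (hρ.tensor hρ') ht).trans
    (FramedRep.isEquivalent_ofRep_weilRestrict_tensor ρ ρ' _ _ _)).trans
    ((h8 ρ r hρ hr).tprod (h8 ρ' r' hρ' hr')).symm

/-- **The truncated model `F̂_nr` satisfies (F15)** (both parts, proved): its de Rham representations
are the unramified ones (`unramifiedPstWeilDeligneData_isDeRhamFramed_iff`), stable under `⊗`, and
its Weil–Deligne relation `r.N = 0 ∧ r.ρ ≅ ρ|_{W_F}` is `⊗`-compatible in the Kronecker frame.  Hence
(F15) is a COMPATIBILITY clause: it does not by itself separate Fontaine's datum from the truncated one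
((F2)/(F11) do). [cite: FontaineAsterisque223III, Prop. 1.5.2] -/
theorem tensorCompatible_unramifiedPstWeilDeligneData [Algebra ℚ_[ℓ] F] :
    (unramifiedPstWeilDeligneData F ℓ).TensorCompatible where
  tensorDeRham := fun m n ρ ρ' hρ hρ' => by
    rw [unramifiedPstWeilDeligneData_isDeRhamFramed_iff] at hρ hρ' ⊢
    exact hρ.tensor hρ'
  tensorWeilDeligne := fun m n ρ ρ' r r' t hr hr' ht => by
    rw [unramifiedPstWeilDeligneData_isWeilDeligneOf_iff] at hr hr' ht
    obtain ⟨hrN, ⟨e⟩⟩ := hr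
    obtain ⟨hr'N, ⟨e'⟩⟩ := hr'
    obtain ⟨htN, ⟨et⟩⟩ := ht
    refine ⟨WeilDeligneRep.Equiv.ofRepEquivOfN
      ((et.trans (ρ.weilRestrictTensorEquiv ρ').symm).trans (e.symm.tprodCongr e'.symm)) htN ?_⟩
    rw [WeilDeligneRep.tprod_N, hrN, hr'N, TensorProduct.map_zero_left, TensorProduct.map_zero_right,
      add_zero]

end PstWeilDeligneData

end Literature.NumberTheory.GaloisRepresentations

end
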